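import Summits.QuantumFields.YangMills.Theses.ColdStartUniversality
import Summits.QuantumFields.YangMills.Theorems.ColdStartUniversalityColdStartSolutionsExistNoise
import Literature.MathematicalPhysics.QuantumLattice.RepLieAlgebraUnitary
import HarnessLib

/-!
# Route `ColdStartUniversality`, support item S = `ColdStartSolutionsExist` (stmt-QuantumFields-24811):
# S from the Shen–Zhu–Zhu well-posedness lemma (CONDITIONAL on the tree's named fact)

Lead `ym-line-csu-p1`.  S asks, for every admissible family `F`, coupling `γ > 0` and step `K`, for a
filtered probability space carrying a flat Brownian driver and a COLD-START (`U 0 = 1`) strong solution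
of the SZZ lattice Langevin SDE `latticeLangevinDynamics (SU(2), fundamental) β'`, `β' = (γ ε_K)⁻¹/2`, on
Bałaban's `K`-th lattice `(ℤ/N_K)³`.

* The probability space is EXPLICIT: `Ω := (Edge 3 N_K × NoiseIdx 2) → (ℝ≥0 → ℝ)`,
  `P := Measure.pi (fun _ => preWienerMeasure)`, `W t ω i := brownian t (ω i)` — a flat Brownian motion
  by `isFlatBrownian_piWiener` (helper file `…ColdStartSolutionsExistNoise`, proved).
* The strong solution is taken from the tree's NAMED FACT `LatticeLangevinWellPosed` (SZZ arXiv:2204.12737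
  §3 Lemma 3.2 = SSZ Lemma 3.2: global strong well-posedness from every initial configuration, printed for
  `SO(N)`/`SU(N)` in the defining representation; `SU(2)` is in scope by
  `LatticeRep.isClassicalDefining_specialUnitaryGroup`).  That fact is a `def … : Prop`, NOT a theorem of
  the tree, so `coldStartSolutionsExist_of_wellPosed` is CONDITIONAL (hypothesis `hWP`); the unconditional
  S needs the Picard construction for the (polynomial, sphere-preserving) SZZ coefficients on `SU(2)^E`,
  registered as the stub `stub_coldStartStrongExistence` of the crux skeleton
  (`Cruxes/ColdStartSolutionsExist/Lines/piwiener.lean`).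

No sorry, no new definition, standard axioms.  RECORD-rung (R3) plumbing: nothing here proves the Yang–Mills
mass gap, Bałaban's limit, or any crux of the route.
-/

set_option autoImplicit false

noncomputable section

namespace Summit.QuantumFields.YangMills.Theorems.ColdStartUniversality

open MeasureTheory ProbabilityTheory
open scoped NNReal
open Literature.Probability.Process Literature.MathematicalPhysics.QuantumFieldTheory
open Literature.MathematicalPhysics.QuantumLattice (fundamentalRep fundamentalLatticeRep)
open Literature.MathematicalPhysics.QuantumFieldTheory.Balaban1983to89

/-- **S on the product Wiener space, from well-posedness at ONE lattice size and coupling.**  If the SZZ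
dynamics for `SU(2)` (fundamental representation) on `(ℤ/L)³` at coupling `β` is well posed in the sense of
the tree's `LatticeLangevinWellPosed`, then on `Ω := (Edge 3 L × NoiseIdx 2) → (ℝ≥0 → ℝ)` with
`P := ⊗ preWienerMeasure` and the coordinate Brownian family `W t ω i = brownian t (ω i)` there is a
cold-start strong solution (`U 0 = 1`) adapted to the raw natural filtration of `W`. -/
theorem exists_coldStart_solution_piWiener_of_wellPosed (L : ℕ) [NeZero L] (β : ℝ)
    (hWP : LatticeLangevinWellPosed (fundamentalLatticeRep 2) 3 L β) :
    ∃ U : ℝ≥0 → ((Edge 3 L × NoiseIdx 2) → (ℝ≥0 → ℝ)) →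
        GaugeConfig 3 L (Matrix.specialUnitaryGroup (Fin 2) ℂ),
      (∀ ω, U 0 ω = fun _ => 1) ∧
      (latticeLangevinDynamics (fundamentalLatticeRep 2) β).IsSolution (fundamentalRep (Fin 2))
        (isFlatBrownian_piWiener 3 L (NoiseIdx 2)).natFiltration
        (Measure.pi fun _ : Edge 3 L × NoiseIdx 2 => preWienerMeasure)
        (fun (t : ℝ≥0) (ω : (Edge 3 L × NoiseIdx 2) → (ℝ≥0 → ℝ)) (i : Edge 3 L × NoiseIdx 2) =>
          brownian t (ω i)) U := by
  haveI := isProbabilityMeasure_piWiener (Edge 3 L × NoiseIdx 2)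
  obtain ⟨U, hU0, hsol, -⟩ := hWP (LatticeRep.isClassicalDefining_specialUnitaryGroup 2)
    ((Edge 3 L × NoiseIdx 2) → (ℝ≥0 → ℝ)) (Measure.pi fun _ => preWienerMeasure)
    (fun t ω i => brownian t (ω i)) (isFlatBrownian_piWiener 3 L (NoiseIdx 2)) (fun _ => 1)
  exact ⟨U, hU0, hsol⟩

/-- **S = `ColdStartSolutionsExist`, CONDITIONAL on SZZ Lemma 3.2** (the tree's named fact
`LatticeLangevinWellPosed` for `SU(2)` in the fundamental representation, `d = 3`, every torus size and
coupling): for every `F`, `γ > 0`, `K` the product Wiener space over `Edge 3 N_K × NoiseIdx 2` with its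
coordinate Brownian family carries a cold-start strong solution at `β' = (γ ε_K)⁻¹/2`.  The flat-Brownian
half is proved (`isFlatBrownian_piWiener`); only the strong-existence half is borrowed.  NOT unconditional:
the gate records a conditional result; the item stays open until `stub_coldStartStrongExistence` lands. -/
theorem coldStartSolutionsExist_of_wellPosed
    (hWP : ∀ (L : ℕ) [NeZero L] (β : ℝ), LatticeLangevinWellPosed (fundamentalLatticeRep 2) 3 L β) :
    Summit.QuantumFields.YangMills.Theses.ColdStartUniversality.ColdStartSolutionsExist := by
  intro F γ K _hγ
  haveI := isProbabilityMeasure_piWiener (Edge 3 ((F.P K).sitesPerDir 0) × NoiseIdx 2)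
  obtain ⟨U, hU0, hsol⟩ := exists_coldStart_solution_piWiener_of_wellPosed ((F.P K).sitesPerDir 0)
    ((γ * (F.P K).eps)⁻¹ / 2) (hWP _ _)
  exact ⟨(Edge 3 ((F.P K).sitesPerDir 0) × NoiseIdx 2) → (ℝ≥0 → ℝ), inferInstance,
    Measure.pi fun _ => preWienerMeasure, inferInstance, fun t ω i => brownian t (ω i),
    isFlatBrownian_piWiener 3 ((F.P K).sitesPerDir 0) (NoiseIdx 2), U, hU0, hsol⟩

end Summit.QuantumFields.YangMills.Theorems.ColdStartUniversality

end
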